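import Summits.NavierStokesRegularity.NavierStokesRegularity.Theorems.ScenarioCensusPitchDefectGauge
import Summits.NavierStokesRegularity.NavierStokesRegularity.Theorems.ScenarioCensusPitchDefectTools
import Summits.NavierStokesRegularity.NavierStokesRegularity.Theorems.SymmetryModuliCountAxisymEndLiouville
import Summits.NavierStokesRegularity.NavierStokesRegularity.Theorems.SymmetryModuliCountSymmetricLiouvilleRotationCovariance
import Summits.NavierStokesRegularity.NavierStokesRegularity.Theorems.ScenarioCensusAncientSymmetry
import HarnessLib.Audit
import HarnessLib

/-!
# Blow-up scenario census — row A2b′ is EXCLUDED-IN-TREE: the fixed-axis lemma (moving-axis Liouville)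

Cell `pub/ns-census` (lead g4 landing assignment 10:21Z).  LANDS the refuter's probe P30 (ns-census-ref
g4, `HOME/ns-census-ref/P30.lean`, 10:18Z); mathematics and Lean text are the ref's, typer-1 g4 only
re-homes it (census ns, `FixedAxis` sub-namespace, census name `row_A2b'_excluded`).  CONED file
(SymmetryModuliCount crux modules `…AxisymEndLiouville` ⟨14061⟩, `…SymmetricLiouvilleRotationCovariance`;
typer-2 g5's `ScenarioCensusPitchDefectGauge/Tools`); the row stays in cone-free `…AncientSymmetry.lean`.
Proof: (1) `PitchDefect.helicalGauge` at pitch `0` (p622138): `u(τ+t₁) = V(τ,·−A(τ)) + γ(τ)e₃` a.e.,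
`V ∈ IsTypeIAncientMild (2C)` axisymmetric about the MOVING axis through `−A(τ)`; (2) the fixed-axis lemma
`FixedAxis.movingAxis_liouville`: axisymmetry about a point propagates forward (rigid covariance + bounded
Oseen-mild uniqueness, `axisym_propagate`), two horizontally distinct axes force axisymmetry about every
point (`axisym_all_of_two`), case split on the first time the axis moves (`liouville_of_fixed_axis_end`);
(3) swirl extinction `AxisymEndLiouville_of` (stubs `stub_swirlWeightProfile`, `stub_swirlComparison`,
`stub_noSwirlLiouville`, landed) — `axisym_liouville_genuine`.  Result: **`row_A2b'_excluded : Row_A2b'`**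
(time-Type-I × axisymmetric WITH swirl × duality class ⇒ slices a.e. `β(t)e₃`).  No summit statement is
proved here; nothing in this file is a claim about NS regularity beyond the displayed Liouville statements.
-/

set_option linter.dupNamespace false

noncomputable section

open MeasureTheory Set Function Filter Metric
open scoped Topology ENNReal NNReal

-- the summit and its single problem share the name `NavierStokesRegularity` (D-0017 nested layout)
namespace Summit.NavierStokesRegularity.NavierStokesRegularity.Theorems.ScenarioCensus

open Literature.Analysis Literature.Analysis.FluidPDE
open Summit.NavierStokesRegularity.NavierStokesRegularity.Theorems
open Summit.NavierStokesRegularity.NavierStokesRegularity.Theorems.ScenarioCensus.PitchDefect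
open Summit.NavierStokesRegularity.NavierStokesRegularity.Theorems.AxisymEndLiouville.AbsorbingAxisSwirlExtinction
open Summit.NavierStokesRegularity.NavierStokesRegularity.Theorems.SymmetryModuliCountSymmetricLiouville

namespace FixedAxis

/-- Two Type-I ancient mild fields which agree at a time `s < 0` agree at every later negative time
(bounded Oseen-mild uniqueness on the window `(s, t/2)` with the common free term `e^{(τ−s)Δ}V(s)`). -/
theorem eq_slice_of_eq_slice {C₁ C₂ s : ℝ} {V W : ℝ → (EuclideanSpace ℝ (Fin 3)) → (EuclideanSpace ℝ (Fin 3))}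
    (hV : IsTypeIAncientMild C₁ V) (hW : IsTypeIAncientMild C₂ W) (hVW : V s = W s)
    {t : ℝ} (hst : s < t) (ht : t < 0) : V t = W t := by
  set T' : ℝ := t / 2 with hT'_def
  have htT' : t < T' := by rw [hT'_def]; linarith
  have hT'0 : T' < 0 := by rw [hT'_def]; linarith
  set M : ℝ := max (C₁ / Real.sqrt (-T')) (C₂ / Real.sqrt (-T')) with hM_def
  have hM0 : 0 ≤ M := le_max_of_le_left (div_nonneg hV.nonneg (Real.sqrt_nonneg _))
  have hVM : ∀ τ ∈ Ioo s T', ∀ y, ‖V τ y‖ ≤ M := fun τ hτ y =>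
    (hV.norm_le_of_mem_Ioo hT'0 hτ y).trans (le_max_left _ _)
  have hWM : ∀ τ ∈ Ioo s T', ∀ y, ‖W τ y‖ ≤ M := fun τ hτ y =>
    (hW.norm_le_of_mem_Ioo hT'0 hτ y).trans (le_max_right _ _)
  have hum := hV.aestronglyMeasurable_uncurry (s := s) hT'0.le
  have hvm := hW.aestronglyMeasurable_uncurry (s := s) hT'0.le
  have hu : ∀ τ ∈ Ioo s T', V τ =ᵐ[volume] fun y =>
      (fun τ y => UnboundedOperators.heatExtension (V s) (τ - s) y) τ y - oseenDuhamel 1 s V V τ y :=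
    fun τ hτ => Eventually.of_forall fun y => hV.mild_eq_heatExtension hτ.1 (hτ.2.trans hT'0) y
  have hv : ∀ τ ∈ Ioo s T', W τ =ᵐ[volume] fun y =>
      (fun τ y => UnboundedOperators.heatExtension (V s) (τ - s) y) τ y - oseenDuhamel 1 s W W τ y := by
    intro τ hτ
    refine Eventually.of_forall fun y => ?_
    rw [hVW]
    exact hW.mild_eq_heatExtension hτ.1 (hτ.2.trans hT'0) y
  have key := oseenMild_bounded_unique one_pos hM0 hum hvm hVM hWM hu hv t ⟨hst, htT'⟩
  exact (Continuous.ae_eq_iff_eq volume (hV.continuous_slice ht) (hW.continuous_slice ht)).1 key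

/-- `rotZ θ` is additive. -/
private theorem rotZ_add_vec (θ : ℝ) (x y : (EuclideanSpace ℝ (Fin 3))) : rotZ θ (x + y) = rotZ θ x + rotZ θ y := by
  simpa using (rotZLIE θ).map_add x y

/-- Elementary identity `rotZ_sub_vec` used by the fixed-axis lemma (ref probe P30). [folklore] -/
private theorem rotZ_sub_vec (θ : ℝ) (x y : (EuclideanSpace ℝ (Fin 3))) : rotZ θ (x - y) = rotZ θ x - rotZ θ y := by
  simpa using (rotZLIE θ).map_sub x y

/-- Elementary identity `rotZ_smul_vec` used by the fixed-axis lemma (ref probe P30). [folklore] -/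
private theorem rotZ_smul_vec (θ c : ℝ) (x : (EuclideanSpace ℝ (Fin 3))) : rotZ θ (c • x) = c • rotZ θ x := by
  simpa only [rotZLIE_apply] using (rotZLIE θ).map_smul c x

/-- Elementary identity `rotZ_neg_vec` used by the fixed-axis lemma (ref probe P30). [folklore] -/
private theorem rotZ_neg_vec (θ : ℝ) (x : (EuclideanSpace ℝ (Fin 3))) : rotZ θ (-x) = -rotZ θ x := by
  simpa using (rotZLIE θ).map_neg x

/-- Elementary identity `rotZ_rotZ_neg'` used by the fixed-axis lemma (ref probe P30). [folklore] -/
private theorem rotZ_rotZ_neg' (θ : ℝ) (x : (EuclideanSpace ℝ (Fin 3))) : rotZ θ (rotZ (-θ) x) = x := by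
  rw [← rotZ_add, add_neg_cancel, rotZ_zero]

/-- Elementary identity `rotZ_neg_rotZ''` used by the fixed-axis lemma (ref probe P30). [folklore] -/
private theorem rotZ_neg_rotZ'' (θ : ℝ) (x : (EuclideanSpace ℝ (Fin 3))) : rotZ (-θ) (rotZ θ x) = x := by
  rw [← rotZ_add, neg_add_cancel, rotZ_zero]

/-- **Forward propagation of axisymmetry.** If the slice `V s` is axisymmetric about the vertical axis
through `a`, so is every later slice `V t`, `s < t < 0`: the rigidly conjugated field
`(τ, y) ↦ R_{−θ} V(τ, R_θ(y − a) + a)` is again in the class and has the same slice at `s`. -/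
theorem axisym_propagate {C : ℝ} {V : ℝ → (EuclideanSpace ℝ (Fin 3)) → (EuclideanSpace ℝ (Fin 3))} (hV : IsTypeIAncientMild C V) {s t : ℝ}
    (hst : s < t) (ht : t < 0) {a : (EuclideanSpace ℝ (Fin 3))} (ha : IsAxisymmetric fun x => V s (x + a)) :
    IsAxisymmetric fun x => V t (x + a) := by
  intro θ x
  show V t (rotZ θ x + a) = rotZ θ (V t (x + a))
  -- the conjugated field
  have h3 := isTypeIAncientMild_comp_add
    (isTypeIAncientMild_conj_linearIsometryEquiv (isTypeIAncientMild_comp_add hV a) (rotZLIE (-θ)))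
    (-a)
  have e : (fun t x => (fun t x => (rotZLIE (-θ)) ((fun t x => V t (x + a)) t ((rotZLIE (-θ)).symm x)))
      t (x + -a)) = fun τ y => rotZ (-θ) (V τ (rotZ θ (y - a) + a)) := by
    funext τ y
    simp [sub_eq_add_neg]
  rw [e] at h3
  have hWs : (fun τ y => rotZ (-θ) (V τ (rotZ θ (y - a) + a))) s = V s := by
    funext y
    have key := ha θ (y - a)
    simp only [sub_add_cancel] at key
    simp only [key, rotZ_neg_rotZ'']
  have heq := congrFun (eq_slice_of_eq_slice h3 hV hWs hst ht) (x + a)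
  simp only [add_sub_cancel_right] at heq
  -- `heq : rotZ (-θ) (V t (rotZ θ x + a)) = V t (x + a)`
  have := congrArg (rotZ θ) heq
  rwa [rotZ_rotZ_neg'] at this

/-- Moving the base point along the axis does not change axisymmetry. -/
theorem axisym_vertical {f : (EuclideanSpace ℝ (Fin 3)) → (EuclideanSpace ℝ (Fin 3))} {a b : (EuclideanSpace ℝ (Fin 3))} (ha : IsAxisymmetric fun x => f (x + a))
    (h0 : a 0 = b 0) (h1 : a 1 = b 1) : IsAxisymmetric fun x => f (x + b) := by
  have hv : b - a = ((b - a) 2) • EuclideanSpace.single (2 : Fin 3) (1 : ℝ) := by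
    ext i
    fin_cases i <;> simp [h0, h1]
  have hrot : ∀ θ, rotZ θ (b - a) = b - a := by
    intro θ
    rw [hv, rotZ_smul_single]
  intro θ x
  have key := ha θ (x + (b - a))
  simp only [rotZ_add_vec, hrot] at key
  have e1 : rotZ θ x + (b - a) + a = rotZ θ x + b := by abel
  have e2 : x + (b - a) + a = x + b := by abel
  rw [e1, e2] at key
  exact key

/-- A genuine Type-I ancient mild field all of whose slices are axisymmetric (with swirl) about the
vertical axis vanishes (`stub_swirlWeightProfile` + `stub_swirlComparison` ⇒ no swirl;
`stub_noSwirlLiouville`). Verbatim the body of `AxisymEndLiouville_of` after its normal form. -/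
theorem axisym_liouville_genuine {C : ℝ} {v : ℝ → (EuclideanSpace ℝ (Fin 3)) → (EuclideanSpace ℝ (Fin 3))} (hv : IsTypeIAncientMild C v)
    (hvaxi : ∀ t < 0, IsAxisymmetric (v t)) : ∀ t < 0, ∀ y, v t y = 0 := by
  have hC : 0 ≤ C := hv.nonneg
  obtain ⟨lam, K, hlam, hK, W, hWc, hW2, hW0, hWK, hW1, hWineq⟩ := stub_swirlWeightProfile C hC
  have hsw : ∀ t < 0, HasNoSwirl (v t) := by
    intro t ht y
    refine abs_nonpos_iff.1 (le_of_forall_pos_le_add fun η hη => ?_)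
    obtain ⟨t', ht', hle⟩ :=
      exists_past_rpow_mul_le (C * K * W (cylRadius y / Real.sqrt (-t))) hlam ht hη
    have key := stub_swirlComparison C lam K W hlam hK hWc hW2 hW0 hWK hW1 hWineq v hv hvaxi
      t' t ht' ht y
    calc |swirl (v t) y| ≤ C * K * (t / t') ^ lam * W (cylRadius y / Real.sqrt (-t)) := key
      _ = C * K * W (cylRadius y / Real.sqrt (-t)) * (t / t') ^ lam := by ring
      _ ≤ η := hle
      _ ≤ 0 + η := by rw [zero_add]
  exact stub_noSwirlLiouville C v hv hvaxi hsw

/-- The horizontal part of a vector. -/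
def horiz (d : (EuclideanSpace ℝ (Fin 3))) : (EuclideanSpace ℝ (Fin 3)) := d - (d 2) • EuclideanSpace.single (2 : Fin 3) (1 : ℝ)

/-- Elementary identity `horiz_apply_zero` used by the fixed-axis lemma (ref probe P30). [folklore] -/
@[simp] theorem horiz_apply_zero (d : (EuclideanSpace ℝ (Fin 3))) : horiz d 0 = d 0 := by simp [horiz]
/-- Elementary identity `horiz_apply_one` used by the fixed-axis lemma (ref probe P30). [folklore] -/
@[simp] theorem horiz_apply_one (d : (EuclideanSpace ℝ (Fin 3))) : horiz d 1 = d 1 := by simp [horiz]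
/-- Elementary identity `horiz_apply_two` used by the fixed-axis lemma (ref probe P30). [folklore] -/
@[simp] theorem horiz_apply_two (d : (EuclideanSpace ℝ (Fin 3))) : horiz d 2 = 0 := by simp [horiz]

section TwoAxes

variable {f : (EuclideanSpace ℝ (Fin 3)) → (EuclideanSpace ℝ (Fin 3))} {a b : (EuclideanSpace ℝ (Fin 3))}

/-- Axisymmetry about `a` and about `b` gives invariance under the translations `d − R_θ d`,
`d = a − b`. -/
theorem inv_of_two (ha : IsAxisymmetric fun x => f (x + a)) (hb : IsAxisymmetric fun x => f (x + b))
    (θ : ℝ) (z : (EuclideanSpace ℝ (Fin 3))) : f (z + ((a - b) - rotZ θ (a - b))) = f z := by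
  have h1 : f (rotZ θ (rotZ (-θ) (z - b)) + b) = rotZ θ (f (rotZ (-θ) (z - b) + b)) := hb θ _
  rw [rotZ_rotZ_neg', sub_add_cancel] at h1
  have h2 : f (rotZ θ (rotZ (-θ) (z - b) + b - a) + a) =
      rotZ θ (f (rotZ (-θ) (z - b) + b - a + a)) := ha θ _
  rw [sub_add_cancel] at h2
  have e : rotZ θ (rotZ (-θ) (z - b) + b - a) + a = z + ((a - b) - rotZ θ (a - b)) := by
    simp only [rotZ_sub_vec, rotZ_add_vec, rotZ_rotZ_neg']
    abel
  rw [e] at h2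
  rw [h2, h1]

/-- … hence under all real multiples of the horizontal part of `a − b` (the sums
`(d − R_θ d) + (d − R_{−θ} d) = (2 − 2cos θ) d_h` fill `[0,4]·d_h`; then reflect and iterate). -/
theorem inv_dir (ha : IsAxisymmetric fun x => f (x + a)) (hb : IsAxisymmetric fun x => f (x + b))
    (c : ℝ) (z : (EuclideanSpace ℝ (Fin 3))) : f (z + c • horiz (a - b)) = f z := by
  -- `c ∈ [0, 4]`
  have hcos : ∀ θ : ℝ, ∀ z, f (z + (2 - 2 * Real.cos θ) • horiz (a - b)) = f z := by
    intro θ z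
    have e : (2 - 2 * Real.cos θ) • horiz (a - b) =
        ((a - b) - rotZ θ (a - b)) + ((a - b) - rotZ (-θ) (a - b)) := by
      ext i
      fin_cases i <;> (simp [horiz, rotZ, Real.cos_neg, Real.sin_neg]; try ring)
    rw [e, ← add_assoc, inv_of_two ha hb (-θ), inv_of_two ha hb θ]
  have h04 : ∀ c : ℝ, 0 ≤ c → c ≤ 4 → ∀ z, f (z + c • horiz (a - b)) = f z := by
    intro c hc0 hc4 z
    have key := hcos (Real.arccos (1 - c / 2)) z
    rwa [Real.cos_arccos (by linarith) (by linarith), show 2 - 2 * (1 - c / 2) = c by ring] at key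
  have h4 : ∀ c : ℝ, |c| ≤ 4 → ∀ z, f (z + c • horiz (a - b)) = f z := by
    intro c hc z
    rcases le_or_gt 0 c with h | h
    · exact h04 c h (le_of_abs_le hc) z
    · have key := h04 (-c) (by linarith) (by linarith [neg_abs_le c, abs_le.1 hc]) (z + c • horiz (a - b))
      rw [add_assoc, ← add_smul, add_neg_cancel, zero_smul, add_zero] at key
      exact key.symm
  have hn : ∀ (m : ℕ) (c : ℝ), |c| ≤ 4 → ∀ z, f (z + ((m : ℝ) * c) • horiz (a - b)) = f z := by
    intro m
    induction m with
    | zero => intro c _ z; simp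
    | succ m ih =>
        intro c hc z
        rw [Nat.cast_succ, add_mul, one_mul, add_smul, ← add_assoc, h4 c hc, ih c hc]
  -- general `c = n · (c/n)` with `|c/n| ≤ 4`
  set n : ℕ := ⌈|c| / 4⌉₊ + 1 with hn_def
  have hn0 : (0 : ℝ) < n := by rw [hn_def]; positivity
  have hcn : |c / n| ≤ 4 := by
    rw [abs_div, abs_of_pos hn0, div_le_iff₀ hn0]
    have h1 : |c| / 4 ≤ (⌈|c| / 4⌉₊ : ℝ) := Nat.le_ceil _
    have h2 : (n : ℝ) = (⌈|c| / 4⌉₊ : ℝ) + 1 := by rw [hn_def]; push_cast; ring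
    rw [h2]
    linarith [abs_nonneg c]
  have key := hn n (c / n) hcn z
  rwa [mul_div_cancel₀ _ hn0.ne'] at key

/-- Axisymmetry about `a` rotates invariance vectors. -/
theorem inv_rot (ha : IsAxisymmetric fun x => f (x + a)) {w : (EuclideanSpace ℝ (Fin 3))} (hw : ∀ z, f (z + w) = f z)
    (φ : ℝ) (z : (EuclideanSpace ℝ (Fin 3))) : f (z + rotZ φ w) = f z := by
  have key : f (rotZ φ (rotZ (-φ) (z - a) + w) + a) = rotZ φ (f (rotZ (-φ) (z - a) + w + a)) :=
    ha φ _
  have e1 : rotZ φ (rotZ (-φ) (z - a) + w) + a = z + rotZ φ w := by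
    simp only [rotZ_add_vec, rotZ_rotZ_neg']
    abel
  have e2 : f (rotZ (-φ) (z - a) + w + a) = rotZ (-φ) (f z) := by
    have k2 : f (rotZ (-φ) (z - a) + a) = rotZ (-φ) (f (z - a + a)) := ha (-φ) _
    rw [sub_add_cancel] at k2
    rw [add_right_comm, hw, k2]
  rw [e1, e2, rotZ_rotZ_neg'] at key
  exact key

/-- **Two axes ⇒ all horizontal translations.** -/
theorem inv_horizontal (ha : IsAxisymmetric fun x => f (x + a))
    (hb : IsAxisymmetric fun x => f (x + b)) (hab : ¬ (a 0 = b 0 ∧ a 1 = b 1))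
    {w : (EuclideanSpace ℝ (Fin 3))} (hw : w 2 = 0) (z : (EuclideanSpace ℝ (Fin 3))) : f (z + w) = f z := by
  have hD : (a 0 - b 0) ^ 2 + (a 1 - b 1) ^ 2 ≠ 0 := by
    intro h
    apply hab
    have h0 : (a 0 - b 0) ^ 2 = 0 := by nlinarith [sq_nonneg (a 0 - b 0), sq_nonneg (a 1 - b 1)]
    have h1 : (a 1 - b 1) ^ 2 = 0 := by nlinarith [sq_nonneg (a 0 - b 0), sq_nonneg (a 1 - b 1)]
    exact ⟨sub_eq_zero.1 (pow_eq_zero_iff two_ne_zero |>.1 h0),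
      sub_eq_zero.1 (pow_eq_zero_iff two_ne_zero |>.1 h1)⟩
  obtain ⟨α, hα⟩ : ∃ α : ℝ,
      α = (w 0 * (a 0 - b 0) + w 1 * (a 1 - b 1)) / ((a 0 - b 0) ^ 2 + (a 1 - b 1) ^ 2) := ⟨_, rfl⟩
  obtain ⟨β, hβ⟩ : ∃ β : ℝ,
      β = (w 1 * (a 0 - b 0) - w 0 * (a 1 - b 1)) / ((a 0 - b 0) ^ 2 + (a 1 - b 1) ^ 2) := ⟨_, rfl⟩
  have c0 : α * (a 0 - b 0) - β * (a 1 - b 1) = w 0 := by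
    rw [hα, hβ]
    field_simp
    ring
  have c1 : α * (a 1 - b 1) + β * (a 0 - b 0) = w 1 := by
    rw [hα, hβ]
    field_simp
    ring
  have hdec : w = α • horiz (a - b) + β • rotZ (Real.pi / 2) (horiz (a - b)) := by
    ext i
    fin_cases i
    · simp [horiz, rotZ]
      linarith [c0]
    · simp [horiz, rotZ]
      linarith [c1]
    · simp [horiz, rotZ, hw]
  have hjd : ∀ c : ℝ, ∀ z, f (z + c • rotZ (Real.pi / 2) (horiz (a - b))) = f z := by
    intro c z
    rw [← rotZ_smul_vec]
    exact inv_rot ha (inv_dir ha hb c) (Real.pi / 2) z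
  rw [hdec, ← add_assoc, hjd β, inv_dir ha hb α]

/-- **Two axes ⇒ every axis.** A field axisymmetric about the vertical axes through two
horizontally distinct points is axisymmetric about the vertical axis through any point. -/
theorem axisym_all_of_two (ha : IsAxisymmetric fun x => f (x + a))
    (hb : IsAxisymmetric fun x => f (x + b)) (hab : ¬ (a 0 = b 0 ∧ a 1 = b 1)) (q : (EuclideanSpace ℝ (Fin 3))) :
    IsAxisymmetric fun x => f (x + q) := by
  intro θ x
  show f (rotZ θ x + q) = rotZ θ (f (x + q))
  have hwh : (q - a - ((q - a) 2) • EuclideanSpace.single (2 : Fin 3) (1 : ℝ)) 2 = 0 := by simp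
  have e1 : rotZ θ x + q = rotZ θ (x + ((q - a) 2) • EuclideanSpace.single (2 : Fin 3) (1 : ℝ)) + a +
      (q - a - ((q - a) 2) • EuclideanSpace.single (2 : Fin 3) (1 : ℝ)) := by
    rw [rotZ_add_vec, rotZ_smul_single]
    abel
  have e2 : x + q = x + ((q - a) 2) • EuclideanSpace.single (2 : Fin 3) (1 : ℝ) + a +
      (q - a - ((q - a) 2) • EuclideanSpace.single (2 : Fin 3) (1 : ℝ)) := by
    abel
  have key : f (rotZ θ (x + ((q - a) 2) • EuclideanSpace.single (2 : Fin 3) (1 : ℝ)) + a) =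
      rotZ θ (f (x + ((q - a) 2) • EuclideanSpace.single (2 : Fin 3) (1 : ℝ) + a)) := ha θ _
  rw [e1, e2, inv_horizontal ha hb hab hwh, inv_horizontal ha hb hab hwh, key]

end TwoAxes

/-- If the (horizontal position of the) axis does not move before time `T ≤ 0`, the field vanishes:
swirl-extinction Liouville on the end `(−∞, T)` (time shift + recentring), then forward uniqueness. -/
theorem liouville_of_fixed_axis_end {C : ℝ} {V : ℝ → (EuclideanSpace ℝ (Fin 3)) → (EuclideanSpace ℝ (Fin 3))} (hV : IsTypeIAncientMild C V)
    (q : ℝ → (EuclideanSpace ℝ (Fin 3))) (hq : ∀ τ < 0, IsAxisymmetric fun x => V τ (x + q τ)) {T : ℝ} (hT : T ≤ 0)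
    (hfix : ∀ τ < T, ∀ s < τ, q s 0 = q τ 0 ∧ q s 1 = q τ 1) : ∀ t < 0, ∀ x, V t x = 0 := by
  have haxi : ∀ τ < T, IsAxisymmetric fun x => V τ (x + q (T - 1)) := by
    intro τ hτ
    rcases lt_trichotomy τ (T - 1) with h | h | h
    · obtain ⟨h0, h1⟩ := hfix (T - 1) (by linarith) τ h
      exact axisym_vertical (hq τ (by linarith)) h0 h1
    · rw [h]; exact hq _ (by linarith)
    · obtain ⟨h0, h1⟩ := hfix τ hτ (T - 1) h
      exact axisym_vertical (hq τ (lt_of_lt_of_le hτ hT)) h0.symm h1.symm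
  have h₁ : IsTypeIAncientMild C (fun t x => V (t + T) (x + q (T - 1))) := by
    have := (isTypeIAncientMild_comp_add hV (q (T - 1))).comp_sub_right (neg_nonneg.2 hT)
    simpa only [sub_neg_eq_add] using this
  have hz := axisym_liouville_genuine h₁ (fun t ht => haxi (t + T) (by linarith))
  have h0 : ∀ t < T, ∀ x, V t x = 0 := by
    intro t ht x
    have := hz (t - T) (by linarith) (x - q (T - 1))
    simpa only [sub_add_cancel] using this
  exact typeIAncientMild_forwardUniqueness hV h0

/-- **Moving-axis Liouville.** A genuine Type-I ancient mild field whose every slice is axisymmetric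
(with swirl) about SOME vertical axis, possibly depending on time, vanishes. -/
theorem movingAxis_liouville {C : ℝ} {V : ℝ → (EuclideanSpace ℝ (Fin 3)) → (EuclideanSpace ℝ (Fin 3))} (hV : IsTypeIAncientMild C V)
    (q : ℝ → (EuclideanSpace ℝ (Fin 3))) (hq : ∀ τ < 0, IsAxisymmetric fun x => V τ (x + q τ)) :
    ∀ τ < 0, ∀ y, V τ y = 0 := by
  -- the times before which the axis has (horizontally) moved
  set E : Set ℝ := {τ | τ < 0 ∧ ∃ s < τ, ¬ (q s 0 = q τ 0 ∧ q s 1 = q τ 1)} with hE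
  by_cases hne : E.Nonempty
  · by_cases hbdd : BddBelow E
    · -- first moving time `τ₁ = inf E < 0`: the axis is fixed on `(−∞, τ₁)`
      have hτ₁le : ∀ e ∈ E, sInf E ≤ e := fun e he => csInf_le hbdd he
      obtain ⟨e₀, he₀⟩ := hne
      have hτ₁0 : sInf E < 0 := lt_of_le_of_lt (hτ₁le e₀ he₀) he₀.1
      refine liouville_of_fixed_axis_end hV q hq hτ₁0.le fun τ hτ s hs => ?_
      by_contra h
      exact absurd (hτ₁le τ ⟨hτ.trans hτ₁0, s, hs, h⟩) (not_le.2 hτ)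
    · -- the axis moved before every time: two axes on every slice, hence axisymmetric about `0`
      have hall : ∀ τ < 0, IsAxisymmetric (V τ) := by
        intro τ hτ
        obtain ⟨e, he, heτ⟩ := not_bddBelow_iff.1 hbdd τ
        obtain ⟨he0, s, hse, hne'⟩ := he
        have h1 : IsAxisymmetric fun x => V τ (x + q s) :=
          axisym_propagate hV (hse.trans heτ) hτ (hq s (hse.trans he0))
        have h2 : IsAxisymmetric fun x => V τ (x + q e) := axisym_propagate hV heτ hτ (hq e he0)
        have key := axisym_all_of_two h1 h2 hne' 0
        simpa only [add_zero] using key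
      exact axisym_liouville_genuine hV hall
  · -- the axis never moves
    refine liouville_of_fixed_axis_end hV q hq le_rfl fun τ hτ s hs => ?_
    by_contra h
    exact hne ⟨τ, hτ, s, hs, h⟩

end FixedAxis

/-- **Row A2b′ is a theorem of the tree**: axisymmetric (with swirl) ancient mild solutions (duality
class, measurable slices) with the time-Type-I rate `‖u(t,x)‖ ≤ C/√(−t)` are slice-wise a.e. axial
constants `β(t) e₃` — `PitchDefect.helicalGauge` at pitch `0`, the fixed-axis lemma
`FixedAxis.movingAxis_liouville`, and the landed swirl-extinction Liouville of crux ⟨14061⟩.  Ref probe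
P30 (ns-census-ref g4), landed by typer-1 g4.  Cell A2b′: EXCLUDED-IN-TREE.
[cite: KochNadirashviliSereginSverak2009, §1 conjecture (L) and Thm 5.2 (arXiv:0709.3599)] -/
theorem row_A2b'_excluded : Row_A2b' := by
  intro u hu hmeas haxi hC t ht
  obtain ⟨C, hC⟩ := hC
  have hhel : ∀ s < 0, ∀ (θ : ℝ) (x : (EuclideanSpace ℝ (Fin 3))),
      u s (rotZ θ x + ((0 : ℝ) * θ) • EuclideanSpace.single 2 (1 : ℝ)) = rotZ θ (u s x) := by
    intro s hs θ x
    rw [zero_mul, zero_smul, add_zero]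
    exact haxi s hs θ x
  have ht2 : t / 2 < 0 := by linarith
  obtain ⟨V, A, γ, hV, -, hVsym, hrep⟩ := helicalGauge hu hmeas hhel hC ht2
  have hq : ∀ τ < 0, IsAxisymmetric fun x => V τ (x + -A τ) := by
    intro τ hτ θ x
    show V τ (rotZ θ x + -A τ) = rotZ θ (V τ (x + -A τ))
    have key := hVsym τ hτ θ (x + -A τ)
    rw [zero_mul, zero_smul, add_zero, FixedAxis.rotZ_add_vec, FixedAxis.rotZ_neg_vec] at key
    have e : rotZ θ x + -rotZ θ (A τ) + (rotZ θ (A τ) - A τ) = rotZ θ x + -A τ := by abel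
    rwa [e] at key
  have hz := FixedAxis.movingAxis_liouville hV (fun τ => -A τ) hq
  refine ⟨γ (t / 2), ?_⟩
  have hrep' := hrep (t / 2) ht2
  rw [show t / 2 + t / 2 = t by ring] at hrep'
  refine hrep'.trans (Eventually.of_forall fun x => ?_)
  show V (t / 2) (x - A (t / 2)) + γ (t / 2) • EuclideanSpace.single 2 (1 : ℝ) =
    γ (t / 2) • FluidPDE.eZ
  rw [hz (t / 2) ht2, zero_add]
  rfl

end Summit.NavierStokesRegularity.NavierStokesRegularity.Theorems.ScenarioCensus

end
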